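import Summits.BirchSwinnertonDyer.BirchSwinnertonDyer.Theorems.GenusKolyvaginAtTwoPowDvdShaCardAtTwoRTNonPhantomPowCore
import Summits.BirchSwinnertonDyer.BirchSwinnertonDyer.Theorems.GenusKolyvaginAtTwoPowDvdShaCardAtTwoRTNonPhantomAtMultiplicative
import HarnessLib

/-!
# Route `GenusKolyvaginAtTwo`, crux L_T `PowDvdShaCardAtTwoRT` (stmt-BirchSwinnertonDyer-23242), LINE 18 stub L, bottom rung:
# the NON-PHANTOM lemma at every level `2^L` — (E) the tree's `H¹` currency: a phantom class of `H¹(K, E[2^L])` that is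
# Kummer at an odd multiplicative place is zero; the `hres` form at every level

Seat `bsd-line-gk2-p3` g22 (PROVER 3/3, cell `bsd-f1-sign2`), `--supports stmt-BirchSwinnertonDyer-23242` (helper).
THEOREMS ONLY (no definition, no named fact, no `sorry`). BSD is not proved by any of this; neither is the crux.
Sequel of `…RTNonPhantomPow{Basis,Layers,Core}` (the algebra at every level, basis form) and of file (V)
`…RTNonPhantomAtMultiplicative` (level `4`), whose local lemmas (`isUnit_natCast_adicCompletionIntegers`, the inertial Tate
transvection `exists_absInertia_unipotent_of_hasMultiplicativeReductionAt`, the principality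
`exists_h1Eval_resGal_eq_of_mem_selmerLocalKer`) are level-free and reused.

WHY. LEAD gk2-p1's `hres_of_nonPhantom_pow` (bottom-rung ENGINE of LINE 18 at every level) asks the NON-PHANTOM condition
`(NPh_M)`: a class of `H¹(K, E[2^M])` dying on `Γ_{K(E[2^M])}` and everywhere Kummer is `0`.  THIS FILE, level `n = 2^L`,
`L ≥ 1`:
* §0 `coboundary_of_unipotent_of_surjective` — the NATURAL FORM of the algebra: `Γ` acting on `M` with `2^L M = 0`, `#M = 4^L`,
  `M[2] ≤ 2^{L-1} M`, every additive automorphism of `M` realised in `Γ`, `u ∈ Γ` unipotent moving `M[2]`: every `1`-cocycle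
  vanishing on the kernel of the action and principal on `u` is a coboundary — **`res : H¹(GL₂(ℤ/2^L), (ℤ/2^L)²) →
  H¹(⟨(1 1; 0 1)⟩, ·)` is injective for every `L ≥ 1`** (coordinates adapted to `u`, the auxiliary elements `−1`, the swap,
  the scalars `1 + 2^i` and `diag(1 + 2^i, 1)` from surjectivity, then `coboundary_of_basis_data`);
* `eq_zero_of_h1Eval_eq_zero_of_unipotent_pow` (any field of characteristic `0`): `ρ̄_{E,2^L}` onto, `u ∈ Γ_F` unipotent on
  `E[2^L]` moving `E[2]`, `x ∈ H¹(F, E[2^L])` with `[x, ρ] = 0` on `Γ_{F(E[2^L])}` and `[x, u]` principal ⟹ `x = 0`;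
* `eq_zero_of_h1Eval_eq_zero_of_mem_selmerLocalKer_pow` (number field): `ρ̄_{E,2^L}` onto, `v ∤ 2` multiplicative with
  `ord_v Δ_min` odd, `x` a phantom in `selmerLocalKer W K_v (2^L)` ⟹ `x = 0`;
* `hres_of_mem_selmerLocalKer_pow` — the `hres` form for `c, y ∈ selmerLocalKer W K_v (2^L)`.
The habitat / `(NPh_M)` forms follow in `…RTNonPhantomPowHabitat`.

References: [LawsonWuthrich2016] §7.1, §8; [GrossLMS1991] Prop. 9.1; [SilvermanATAEC1994] IV.9.2 (d), V.5, Ex. 5.13 (b);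
[SerreAbelianLadic1968] IV A.1.2; [McCallumLMS1991] §3.
-/

-- `Summit.<P>.<Sub>` repeats `BirchSwinnertonDyer` by the tree's layout convention (D-0017)
set_option linter.dupNamespace false
set_option autoImplicit false

noncomputable section

open scoped Classical NNReal
open NumberField IsDedekindDomain Field

universe u

/-! ## §0 Abstract: `Γ ↠ Aut M`, `M ≅ (ℤ/2^L)²`, one unipotent `u` moving `M[2]` -/

namespace Summit.BirchSwinnertonDyer.BirchSwinnertonDyer.Theorems.GenusExact.NonPhantomPow

open Summit.BirchSwinnertonDyer.BirchSwinnertonDyer.Theorems.GenusExact.NonPhantom (smul_zsmul_comm smul_lincomb)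

section Surjective

variable {Γ : Type*} [Group Γ] {M : Type*} [AddCommGroup M] [DistribMulAction Γ M]

/-- `b • P = 0 → 2^L ∣ b` for `P` of exact order `2^L` (`2^L P = 0`, `2^{L-1} P ≠ 0`). [folklore] -/
theorem dvd_of_zsmul_eq_zero_of_order {L : ℕ} {P : M} (hq : ((2 : ℤ) ^ L) • P = 0)
    (hhalf : ((2 : ℤ) ^ (L - 1)) • P ≠ 0) {b : ℤ} (hb : b • P = 0) : (2 : ℤ) ^ L ∣ b := by
  have hord : addOrderOf P ∣ 2 ^ L := by
    rw [addOrderOf_dvd_iff_nsmul_eq_zero, ← natCast_zsmul]; exact_mod_cast hq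
  obtain ⟨k, hk, hkeq⟩ := (Nat.dvd_prime_pow Nat.prime_two).mp hord
  have hkL : k = L := by
    by_contra hne
    have hk' : k ≤ L - 1 := by omega
    apply hhalf
    have : addOrderOf P ∣ 2 ^ (L - 1) := by rw [hkeq]; exact pow_dvd_pow 2 hk'
    rw [addOrderOf_dvd_iff_nsmul_eq_zero] at this
    rw [← natCast_zsmul] at this
    exact_mod_cast this
  have h := (addOrderOf_dvd_iff_zsmul_eq_zero (x := P) (i := b)).mpr hb
  rw [hkeq, hkL] at h
  exact_mod_cast h

/-- Multiplication by an integer coprime to the exponent is an automorphism. [folklore] -/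
theorem exists_addEquiv_zsmul {A : Type*} [AddCommGroup A] {q c : ℤ} (hqA : ∀ a : A, q • a = 0)
    (hc : IsCoprime c q) : ∃ F : A ≃+ A, ∀ a, F a = c • a := by
  obtain ⟨d, e, hde⟩ := hc
  have h₁ : ∀ a : A, d • c • a = a := fun a ↦ by
    rw [smul_smul, show d * c = 1 - e * q by rw [← hde]; ring, sub_smul, one_smul, mul_smul, hqA, smul_zero, sub_zero]
  have h₂ : ∀ a : A, c • d • a = a := fun a ↦ by
    rw [smul_smul, show c * d = 1 - e * q by rw [← hde]; ring, sub_smul, one_smul, mul_smul, hqA, smul_zero, sub_zero]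
  exact ⟨AddEquiv.mk' ⟨fun a ↦ c • a, fun a ↦ d • a, h₁, h₂⟩ (smul_add c), fun a ↦ rfl⟩

/-- `1 + 2^i` is coprime to `2^L` for `i ≥ 1`. [folklore] -/
theorem isCoprime_one_add_two_pow {i : ℕ} (hi : 1 ≤ i) (L : ℕ) : IsCoprime (1 + 2 ^ i : ℤ) (2 ^ L) := by
  apply IsCoprime.pow_right
  obtain ⟨t, ht⟩ : ∃ t : ℤ, (2 : ℤ) ^ i = 2 * t := ⟨2 ^ (i - 1), by rw [← pow_succ']; congr 1; omega⟩
  exact ⟨1, -t, by rw [ht]; ring⟩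

/-- **THE NON-PHANTOM LEMMA, natural form, every level.**  Let `Γ` act on `M` with `2^L M = 0` (`L ≥ 1`), `#M = 4^L`,
`M[2] ≤ 2^{L-1} M` (so `M ≅ (ℤ/2^L)²`), and EVERY additive automorphism of `M` realised in `Γ` (the tree's
`HasSurjectiveModNGaloisRep (2^L)`).  Let `u ∈ Γ` be unipotent (`u (u m − m) = u m − m`) and move some element of `M[2]` (the
Tate transvection of a multiplicative prime with `ord_v Δ` odd).  Then every `1`-cocycle vanishing on the kernel of the action
(a PHANTOM class: dying on `Γ_{K(E[2^L])}`) and principal on `u` is a coboundary — the injectivity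
`H¹(GL₂(ℤ/2^L), (ℤ/2^L)²) → H¹(⟨(1 1; 0 1)⟩, (ℤ/2^L)²)` (Lawson–Wuthrich's localisation kernel at one cyclic subgroup, every
level). [cite: LawsonWuthrich2016, §7.1 and §8] [cite: SerreAbelianLadic1968, Ch. IV, A.1.2] -/
theorem coboundary_of_unipotent_of_surjective {L : ℕ} (hL : 1 ≤ L) (hqM : ∀ m : M, ((2 : ℤ) ^ L) • m = 0)
    (hcard : Nat.card M = (2 ^ L) ^ 2)
    (h2M : ∀ m : M, (2 : ℤ) • m = 0 → ∃ y : M, m = ((2 : ℤ) ^ (L - 1)) • y)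
    (hsurj : ∀ f : M ≃+ M, ∃ a : Γ, ∀ m : M, a • m = f m)
    {u : Γ} (hu₁ : ∀ m : M, u • (u • m - m) = u • m - m) (hu₂ : ∃ Q : M, (2 : ℤ) • Q = 0 ∧ u • Q ≠ Q)
    {φ : Γ → M} (hφ : ∀ a b, φ (a * b) = φ a + a • φ b)
    (hker : ∀ ρ : Γ, (∀ m : M, ρ • m = m) → φ ρ = 0) (hφu : ∃ m : M, φ u = u • m - m) :
    ∃ v : M, ∀ a, φ a = a • v - v := by
  classical
  set q : ℤ := (2 : ℤ) ^ L with hq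
  have hLsucc : L - 1 + 1 = L := by omega
  -- the basis adapted to `u`
  obtain ⟨Q, h2Q, huQ⟩ := hu₂
  obtain ⟨P₂, hP₂⟩ := h2M Q h2Q
  obtain ⟨P₁, hP₁⟩ : ∃ P₁ : M, P₁ = u • P₂ - P₂ := ⟨_, rfl⟩
  have huP₁ : u • P₁ = P₁ := by rw [hP₁]; exact hu₁ P₂
  have huP₂ : u • P₂ = P₁ + P₂ := by rw [hP₁, sub_add_cancel]
  have hQ0 : Q ≠ 0 := by rintro rfl; exact huQ (smul_zero u)
  have hhalfP₂ : ((2 : ℤ) ^ (L - 1)) • P₂ ≠ 0 := by rw [← hP₂]; exact hQ0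
  have hhalfP₁ : ((2 : ℤ) ^ (L - 1)) • P₁ ≠ 0 := by
    rw [hP₁, smul_sub, ← smul_zsmul_comm, ← hP₂, sub_ne_zero]; exact huQ
  have hindep : ∀ a b : ℤ, a • P₁ + b • P₂ = 0 → q ∣ a ∧ q ∣ b := by
    intro a b hab
    have hu : a • P₁ + b • (P₁ + P₂) = 0 := by
      calc a • P₁ + b • (P₁ + P₂) = u • (a • P₁ + b • P₂) := by rw [smul_lincomb, huP₁, huP₂]
        _ = 0 := by rw [hab, smul_zero]
    have hbP : b • P₁ = 0 := by
      rw [show b • P₁ = a • P₁ + b • (P₁ + P₂) - (a • P₁ + b • P₂) by module, hu, hab, sub_zero]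
    have hb := dvd_of_zsmul_eq_zero_of_order (hqM P₁) hhalfP₁ hbP
    have haP : a • P₁ = 0 := by rwa [zsmul_eq_zero_of_dvd (hqM P₂) hb, add_zero] at hab
    exact ⟨dvd_of_zsmul_eq_zero_of_order (hqM P₁) hhalfP₁ haP, hb⟩
  -- the coordinate map `ZMod (2^L) × ZMod (2^L) →+ M`
  have hn : ((2 ^ L : ℕ) : ℤ) = q := by rw [hq]; norm_cast
  have h4P₁ : (zmultiplesHom M P₁) ((2 ^ L : ℕ) : ℤ) = 0 := by rw [zmultiplesHom_apply, hn]; exact hqM P₁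
  have h4P₂ : (zmultiplesHom M P₂) ((2 ^ L : ℕ) : ℤ) = 0 := by rw [zmultiplesHom_apply, hn]; exact hqM P₂
  obtain ⟨f, hf⟩ : ∃ f : ZMod (2 ^ L) × ZMod (2 ^ L) →+ M,
      f = (ZMod.lift (2 ^ L) ⟨zmultiplesHom M P₁, h4P₁⟩).coprod (ZMod.lift (2 ^ L) ⟨zmultiplesHom M P₂, h4P₂⟩) :=
    ⟨_, rfl⟩
  have hfapp : ∀ a b : ℤ, f ((a : ZMod (2 ^ L)), (b : ZMod (2 ^ L))) = a • P₁ + b • P₂ := by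
    intro a b
    rw [hf, AddMonoidHom.coprod_apply, ZMod.lift_coe, ZMod.lift_coe]
    rfl
  haveI : NeZero (2 ^ L) := ⟨pow_ne_zero L two_ne_zero⟩
  have hfinj : Function.Injective f := by
    rw [injective_iff_map_eq_zero]
    rintro ⟨x, y⟩ hxy
    rw [← ZMod.intCast_zmod_cast x, ← ZMod.intCast_zmod_cast y, hfapp] at hxy
    obtain ⟨hx, hy⟩ := hindep _ _ hxy
    rw [Prod.mk_eq_zero, ← ZMod.intCast_zmod_cast x, ← ZMod.intCast_zmod_cast y,
      ZMod.intCast_zmod_eq_zero_iff_dvd, ZMod.intCast_zmod_eq_zero_iff_dvd]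
    exact ⟨by rw [hn]; exact hx, by rw [hn]; exact hy⟩
  haveI : Finite M := Nat.finite_of_card_ne_zero (by rw [hcard]; positivity)
  have hfbij : Function.Bijective f :=
    hfinj.bijective_of_nat_card_le (by rw [hcard, Nat.card_prod, Nat.card_zmod, sq])
  have hspan : ∀ m : M, ∃ a b : ℤ, m = a • P₁ + b • P₂ := by
    intro m
    obtain ⟨⟨x, y⟩, rfl⟩ := hfbij.2 m
    exact ⟨x.cast, y.cast, by rw [← hfapp, ZMod.intCast_zmod_cast, ZMod.intCast_zmod_cast]⟩
  obtain ⟨e, he⟩ : ∃ e : ZMod (2 ^ L) × ZMod (2 ^ L) ≃+ M, ∀ p, e p = f p :=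
    ⟨AddEquiv.ofBijective f hfbij, fun _ ↦ rfl⟩
  have heab : ∀ a b : ℤ, e ((a : ZMod (2 ^ L)), (b : ZMod (2 ^ L))) = a • P₁ + b • P₂ := fun a b ↦ by rw [he, hfapp]
  have he10 : e (1, 0) = P₁ := by
    have := heab 1 0; rwa [Int.cast_one, Int.cast_zero, one_smul, zero_smul, add_zero] at this
  have he01 : e (0, 1) = P₂ := by
    have := heab 0 1; rwa [Int.cast_one, Int.cast_zero, one_smul, zero_smul, zero_add] at this
  have heP₁ : e.symm P₁ = (1, 0) := by rw [AddEquiv.symm_apply_eq, he10]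
  have heP₂ : e.symm P₂ = (0, 1) := by rw [AddEquiv.symm_apply_eq, he01]
  -- auxiliary elements: `zneg = −1`, the swap `s`, the scalars `z i` and the `g i = diag(1 + 2^i, 1)`
  obtain ⟨zneg, hzneg⟩ := hsurj (AddEquiv.neg M)
  simp only [AddEquiv.neg_apply] at hzneg
  obtain ⟨s, hs⟩ := hsurj (e.symm.trans ((AddEquiv.prodComm).trans e))
  have hsP₁ : s • P₁ = P₂ := by
    rw [hs, AddEquiv.trans_apply, AddEquiv.trans_apply, heP₁, AddEquiv.coe_prodComm, Prod.swap_prod_mk, he01]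
  have hsP₂ : s • P₂ = P₁ := by
    rw [hs, AddEquiv.trans_apply, AddEquiv.trans_apply, heP₂, AddEquiv.coe_prodComm, Prod.swap_prod_mk, he10]
  -- scalars: for `i ≥ 1` realise `m ↦ (1 + 2^i) m`; for `i = 0` any element (never used) — take `1`
  have hzex : ∀ i : ℕ, ∃ zi : Γ, 1 ≤ i → ∀ m : M, zi • m = (1 + 2 ^ i : ℤ) • m := by
    intro i
    by_cases hi : 1 ≤ i
    · obtain ⟨F, hF⟩ := exists_addEquiv_zsmul hqM (isCoprime_one_add_two_pow hi L)
      obtain ⟨zi, hzi⟩ := hsurj F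
      exact ⟨zi, fun _ m ↦ by rw [hzi, hF]⟩
    · exact ⟨1, fun h ↦ absurd h hi⟩
  choose z hz using hzex
  have hqZ : ∀ x : ZMod (2 ^ L), q • x = 0 := fun x ↦ by
    have h0 : ((2 ^ L : ℕ) : ZMod (2 ^ L)) = 0 := ZMod.natCast_self _
    rw [← hn, zsmul_eq_mul, Int.cast_natCast, h0, zero_mul]
  have hgex : ∀ i : ℕ, ∃ gi : Γ, 1 ≤ i → gi • P₁ = (1 + 2 ^ i : ℤ) • P₁ ∧ gi • P₂ = P₂ := by
    intro i
    by_cases hi : 1 ≤ i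
    · obtain ⟨F, hF⟩ := exists_addEquiv_zsmul hqZ (isCoprime_one_add_two_pow hi L)
      obtain ⟨gi, hgi⟩ := hsurj (e.symm.trans ((AddEquiv.prodCongr F (AddEquiv.refl _)).trans e))
      refine ⟨gi, fun _ ↦ ⟨?_, ?_⟩⟩
      · rw [hgi, AddEquiv.trans_apply, AddEquiv.trans_apply, heP₁,
          show (AddEquiv.prodCongr F (AddEquiv.refl (ZMod (2 ^ L)))) (1, 0) = (F 1, 0) from rfl, hF,
          zsmul_eq_mul, mul_one, ← Int.cast_zero, heab, zero_smul, add_zero]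
      · rw [hgi, AddEquiv.trans_apply, AddEquiv.trans_apply, heP₂,
          show (AddEquiv.prodCongr F (AddEquiv.refl (ZMod (2 ^ L)))) (0, 1) = (F 0, 1) from rfl, hF, smul_zero, he01]
    · exact ⟨1, fun h ↦ absurd h hi⟩
  choose g hg using hgex
  exact coboundary_of_basis_data hL hq hqM hspan hindep huP₁ huP₂ hsP₁ hsP₂ hzneg hz (fun i hi ↦ (hg i hi).1)
    (fun i hi ↦ (hg i hi).2) hφ hker hφu

end Surjective

end Summit.BirchSwinnertonDyer.BirchSwinnertonDyer.Theorems.GenusExact.NonPhantomPow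

/-! ## §1 Any field: a phantom class of `H¹(F, E[2^L])` whose cocycle is principal on a Tate transvection is zero -/

namespace Summit.BirchSwinnertonDyer.BirchSwinnertonDyer.Theorems.GenusExact.NonPhantomPow

open WeierstrassCurve Literature.NumberTheory.EllipticCurves Literature.NumberTheory.GaloisRepresentations Field
open Summit.BirchSwinnertonDyer.BirchSwinnertonDyer.Theorems.GenusExact.NonPhantom (isUnit_natCast_adicCompletionIntegers
  exists_absInertia_unipotent_of_hasMultiplicativeReductionAt exists_h1Eval_resGal_eq_of_mem_selmerLocalKer)

variable {F : Type u} [Field F] (W : WeierstrassCurve F)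

/-- `E[2^L]` is killed by `2^L`. [folklore] -/
theorem pow_zsmul_geomTorsion_eq_zero {L : ℕ} {n : ℤ} (hn : n = ((2 ^ L : ℕ) : ℤ)) (m : geomTorsion W n) :
    ((2 : ℤ) ^ L) • m = 0 := by
  have key : (2 : ℤ) ^ L = n := by rw [hn]; push_cast; ring
  rw [key]
  exact Subtype.ext ((Submodule.mem_torsionBy_iff n (m : geomPoints W)).mp m.2)

/-- `E[2^L][2] ≤ 2^{L-1} · E[2^L]` (divisibility of `E(F̄)`). [cite: SilvermanAEC2009, §VIII.2 and Prop. III.4.2(a)] -/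
theorem exists_eq_pow_zsmul_of_two_zsmul_eq_zero [W.IsElliptic] {L : ℕ} (hL : 1 ≤ L) {n : ℤ}
    (hn : n = ((2 ^ L : ℕ) : ℤ)) (m : geomTorsion W n) (hm : (2 : ℤ) • m = 0) :
    ∃ y : geomTorsion W n, m = ((2 : ℤ) ^ (L - 1)) • y := by
  obtain ⟨Q, hQ⟩ := W.zsmul_geomPoints_surjective_holds (n := (2 : ℤ) ^ (L - 1)) (pow_ne_zero _ two_ne_zero)
    (m : geomPoints W)
  have hQ' : ((2 : ℤ) ^ (L - 1)) • Q = (m : geomPoints W) := hQ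
  have h2 : (2 : ℤ) • (m : geomPoints W) = 0 := congrArg Subtype.val hm
  have hQn : Q ∈ geomTorsion W n := by
    refine (Submodule.mem_torsionBy_iff _ Q).mpr ?_
    change n • Q = 0
    have hn' : n = 2 * 2 ^ (L - 1) := by
      rw [hn]
      conv_lhs => rw [show L = L - 1 + 1 by omega]
      push_cast
      ring
    rw [hn', mul_smul, hQ', h2]
  exact ⟨⟨Q, hQn⟩, Subtype.ext hQ'.symm⟩

/-- **THE NON-PHANTOM LEMMA in the tree's `H¹` currency, every level `2^L` (`L ≥ 1`).**  Let `E/F` be an elliptic curve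
(`char F = 0`) with `ρ̄_{E,2^L} : Γ_F → Aut E[2^L]` SURJECTIVE, and let `u ∈ Γ_F` act unipotently on `E[2^L]`
(`u (u P − P) = u P − P`) and move a point of `E[2]` — e.g. an inertia element at a place `v ∤ 2` of multiplicative
reduction with `ord_v Δ_min` odd.  If `x ∈ H¹(F, E[2^L])` has `[x, ρ] = 0` for every `ρ ∈ Γ_{F(E[2^L])}` (a PHANTOM class)
and its cocycle is principal on `u`, then `x = 0`.  Proof: `NonPhantomPow.coboundary_of_unipotent_of_surjective` applied
to the chosen cocycle of `x`. [cite: LawsonWuthrich2016, §7.1 and §8] [cite: GrossLMS1991, Prop. 9.1]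
[cite: SerreAbelianLadic1968, Ch. IV, A.1.2] -/
theorem eq_zero_of_h1Eval_eq_zero_of_unipotent_pow [CharZero F] [W.IsElliptic] {L : ℕ} (hL : 1 ≤ L) {n : ℤ}
    (hn : n = ((2 ^ L : ℕ) : ℤ)) (hρ : W.HasSurjectiveModNGaloisRep n)
    {u : absoluteGaloisGroup F} (hu₁ : ∀ P : geomTorsion W n, u • (u • P - P) = u • P - P)
    (hu₂ : ∃ Q : geomTorsion W n, (2 : ℤ) • Q = 0 ∧ u • Q ≠ Q)
    {x : galH1Torsion W n} (hx : ∀ ρ ∈ torsionFixing W n, h1Eval W n x ρ = 0)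
    (hxu : ∃ m : geomTorsion W n, h1Eval W n x u = u • m - m) : x = 0 := by
  have hqM := pow_zsmul_geomTorsion_eq_zero W hn
  have h2M := exists_eq_pow_zsmul_of_two_zsmul_eq_zero W hL hn
  have hcard : Nat.card (geomTorsion W n) = (2 ^ L) ^ 2 := by
    rw [natCard_geomTorsion W n (by rw [hn]; positivity), hn, Int.natAbs_natCast]
  -- the chosen cocycle of `x`
  have hφ : ∀ g h, (reprCocycle W n x).1 (g * h) = (reprCocycle W n x).1 g + g • (reprCocycle W n x).1 h :=
    fun g h ↦ by have := (reprCocycle W n x).2 g h; rwa [discreteTopRep_ρ_apply] at this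
  have hker : ∀ ρ : absoluteGaloisGroup F, (∀ m : geomTorsion W n, ρ • m = m) → (reprCocycle W n x).1 ρ = 0 :=
    fun ρ hρ ↦ hx ρ ((mem_torsionFixing_iff W n).mpr hρ)
  have hsurj : ∀ f : geomTorsion W n ≃+ geomTorsion W n, ∃ g : absoluteGaloisGroup F, ∀ m, g • m = f m := by
    intro f
    obtain ⟨g, hg⟩ := hρ (Multiplicative.ofAdd f)
    refine ⟨g, fun m ↦ ?_⟩
    rw [← galoisRepTorsion_apply W n g m, hg]
    rfl
  obtain ⟨v, hv⟩ := coboundary_of_unipotent_of_surjective hL hqM hcard h2M hsurj hu₁ hu₂ hφ hker hxu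
  rw [← oneCocycleClass_reprCocycle W n x]
  exact (oneCocycleClass_eq_zero_iff _ _).mpr ⟨v, fun g ↦ by rw [discreteTopRep_ρ_apply]; exact hv g⟩

end Summit.BirchSwinnertonDyer.BirchSwinnertonDyer.Theorems.GenusExact.NonPhantomPow

/-! ## §2 Number fields: a phantom class of `H¹(K, E[2^L])` that is Kummer at an odd multiplicative place is zero -/

namespace Summit.BirchSwinnertonDyer.BirchSwinnertonDyer.Theorems.GenusExact.NonPhantomPow

open WeierstrassCurve Literature.NumberTheory.EllipticCurves Literature.NumberTheory.GaloisRepresentations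
  IsDedekindDomain.HeightOneSpectrum
  Literature.NumberTheory.GaloisRepresentations.IsNonarchimedeanLocalField
open Summit.BirchSwinnertonDyer.BirchSwinnertonDyer.Theorems.GenusExact.NonPhantom (isUnit_natCast_adicCompletionIntegers
  exists_absInertia_unipotent_of_hasMultiplicativeReductionAt exists_h1Eval_resGal_eq_of_mem_selmerLocalKer)

variable {K : Type u} [Field K] [NumberField K] (W : WeierstrassCurve K) {v : HeightOneSpectrum (𝓞 K)}

/-- `2^L` is a unit at a place not above `2`. [folklore] -/
theorem isUnit_two_pow_adicCompletionIntegers (h2v : ((2 : ℕ) : 𝓞 K) ∉ v.asIdeal) (L : ℕ) :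
    IsUnit ((2 ^ L : ℕ) : v.adicCompletionIntegers K) := by
  have h2 := isUnit_natCast_adicCompletionIntegers (K := K) (v := v) (m := 2) h2v
  rw [Nat.cast_pow]
  exact h2.pow L

/-- **THE NON-PHANTOM LEMMA at an odd multiplicative place, every level `2^L`.**  Let `E/K` be an elliptic curve over a
number field with `ρ̄_{E,2^L} : Γ_K → Aut E[2^L]` surjective (`L ≥ 1`), and `v ∤ 2` a place of MULTIPLICATIVE reduction with
`ord_v Δ_min` ODD.  A class `x ∈ H¹(K, E[2^L])` which (i) is a PHANTOM — `[x, ρ] = 0` for all `ρ ∈ Γ_{K(E[2^L])}` — and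
(ii) satisfies the local Kummer (Selmer) condition at `v` (`x ∈ selmerLocalKer W K_v (2^L)`) is ZERO.  Proof: the inertia
group at `v` contains `τ` acting on `E[2^L]` as the Tate transvection (`2 ∤ ord_v Δ`); the cocycle of `x` is principal on
`τ` (`gcd(2^L, ord_v Δ) = 1`); and restriction from `GL₂(ℤ/2^L)` to `⟨τ⟩` is injective on `H¹(·, (ℤ/2^L)²)`
(`eq_zero_of_h1Eval_eq_zero_of_unipotent_pow`).
[cite: LawsonWuthrich2016, §7.1 and §8] [cite: SilvermanATAEC1994, Exercise 5.13 (b) and Cor. IV.9.2 (d)]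
[cite: GrossLMS1991, Prop. 9.1] -/
theorem eq_zero_of_h1Eval_eq_zero_of_mem_selmerLocalKer_pow [W.IsElliptic]
    (hmult : W.HasMultiplicativeReductionAt v) (h2v : ((2 : ℕ) : 𝓞 K) ∉ v.asIdeal)
    (hodd : Odd (W.ordMinimalDiscriminant v)) {L : ℕ} (hL : 1 ≤ L) {n : ℤ} (hn : n = ((2 ^ L : ℕ) : ℤ))
    (hρ : W.HasSurjectiveModNGaloisRep n)
    {x : galH1Torsion W n} (hx : ∀ ρ ∈ torsionFixing W n, h1Eval W n x ρ = 0)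
    (hxv : x ∈ selmerLocalKer W (v.adicCompletion K) n) : x = 0 := by
  subst hn
  have hndvd : ¬ 2 ∣ W.ordMinimalDiscriminant v := hodd.not_two_dvd_nat
  obtain ⟨τ, hτ, hu₁, Q, hQ2, hQne⟩ := exists_absInertia_unipotent_of_hasMultiplicativeReductionAt W hmult
    Nat.prime_two h2v hndvd (k := L) hL (N := ((2 ^ L : ℕ) : ℤ)) rfl
  have hcop : (2 ^ L : ℕ).Coprime (W.ordMinimalDiscriminant v) :=
    (Nat.coprime_two_left.mpr hodd).pow_left L
  obtain ⟨m, hm⟩ := exists_h1Eval_resGal_eq_of_mem_selmerLocalKer W hmult (n := 2 ^ L) (pow_ne_zero L two_ne_zero)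
    (isUnit_two_pow_adicCompletionIntegers h2v L) hcop hxv hτ
  refine eq_zero_of_h1Eval_eq_zero_of_unipotent_pow W hL rfl hρ hu₁ ⟨Q, ?_, hQne⟩ hx ⟨m, hm⟩
  rw [two_zsmul]
  rwa [two_nsmul] at hQ2

/-- **The separation hypothesis `hres` of the pair Čebotarev at level `2^L`, for spans of classes that are Kummer at an
odd multiplicative place.**  Same curve and place; if `c, y ∈ H¹(K, E[2^L])` both satisfy the local Kummer condition at `v`,
then no non-zero `a • c + b • y` is a phantom — the hypothesis `hres` of
`PlusDescent.infinite_kolyvaginPrime_localization_fullOrder_pair` / the LEAD's `hres_of_nonPhantom_pow` at `M = L`.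
[cite: LawsonWuthrich2016, §7.1 and §8] [cite: McCallumLMS1991, §3 Cor. 3.2] -/
theorem hres_of_mem_selmerLocalKer_pow [W.IsElliptic]
    (hmult : W.HasMultiplicativeReductionAt v) (h2v : ((2 : ℕ) : 𝓞 K) ∉ v.asIdeal)
    (hodd : Odd (W.ordMinimalDiscriminant v)) {L : ℕ} (hL : 1 ≤ L) {n : ℤ} (hn : n = ((2 ^ L : ℕ) : ℤ))
    (hρ : W.HasSurjectiveModNGaloisRep n)
    {c y : galH1Torsion W n} (hc : c ∈ selmerLocalKer W (v.adicCompletion K) n)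
    (hy : y ∈ selmerLocalKer W (v.adicCompletion K) n) :
    ∀ a b : ℤ, (∀ ρ ∈ torsionFixing W n, h1Eval W n (a • c + b • y) ρ = 0) → a • c + b • y = 0 :=
  fun a b hab ↦ eq_zero_of_h1Eval_eq_zero_of_mem_selmerLocalKer_pow W hmult h2v hodd hL hn hρ hab
    ((selmerLocalKer W _ n).add_mem ((selmerLocalKer W _ n).zsmul_mem hc a)
      ((selmerLocalKer W _ n).zsmul_mem hy b))

end Summit.BirchSwinnertonDyer.BirchSwinnertonDyer.Theorems.GenusExact.NonPhantomPow

end
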